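import Summits.CriticalPhenomena.CardyFormulaZ2.Theorems.CardySusyWardDiscretisationFamilyExistsLocalSearch
import Literature.Probability.LatticeModels.PlanarIsingMeshTranslate
import Mathlib.Analysis.Normed.Operator.LinearIsometry
import HarnessLib

/-!
# Transport of the mesh dictionary along lattice isometries — helper for `DiscretisationFamilyExists` (stmt-CriticalPhenomena-9644)

A *lattice isometry* is a pair `g : Site 2 ≃ Site 2`, `G : ℂ ≃ₗᵢ[ℝ] ℂ` with
`meshPoint δ (g x) = G (meshPoint δ x)` (rotations by right angles, reflections in the axes, and
their composites).  Along such a pair every notion of the discretisation of `Ω` corresponds to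
the same notion for `G '' Ω`: lattice adjacency, mesh vertices, the mesh graph, reachability and
component sizes, the discrete domain `meshDomain` (largest component), the graph `Ω_δ`, and the
distance to the frontier.  (Faces and the discrete boundary: `…ExistsTransportB`.)  Modelled on
the translation dictionary of `Literature/Probability/LatticeModels/PlanarIsingMeshTranslate.lean`
(whose `reachable_congr_set`, `mem_image_supp_iff`, `mem_meshDomain_iff_ncard` are reused); it is a
hypothesis-weaker variant (only `δ > 0` and `meshPoint δ (g x) = G (meshPoint δ x)`) of the
`CellSymmetry` dictionary of `Literature/Probability/LatticeModels/CellGridSaddleSymmetry.lean`,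
which additionally asks for face/flip/coin compatibility.
-/

noncomputable section

open Set Metric
open Literature.Probability.LatticeModels Literature.Probability.Percolation
  Literature.Probability.LatticeModels.DiscreteDobrushin

namespace Summit.CriticalPhenomena.CardyFormulaZ2.Theorems.DiscretisationFamilyExists

section Transport

variable {Ω : Set ℂ} {δ : ℝ} {g : Site 2 ≃ Site 2} {G : ℂ ≃ₗᵢ[ℝ] ℂ}

/-! ### Generalities on the pair `(g, G)` -/

/-- The inverse of a lattice isometry is a lattice isometry. [folklore] -/
theorem meshPoint_symm (hG : ∀ x : Site 2, meshPoint δ (g x) = G (meshPoint δ x)) (x : Site 2) :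
    meshPoint δ (g.symm x) = G.symm (meshPoint δ x) := by
  apply G.injective
  rw [← hG, Equiv.apply_symm_apply, LinearIsometryEquiv.apply_symm_apply]

/-- `G⁻¹ (G Ω) = Ω`. [folklore] -/
theorem symm_image_image (G : ℂ ≃ₗᵢ[ℝ] ℂ) (Ω : Set ℂ) : G.symm '' (G '' Ω) = Ω :=
  G.toEquiv.symm_image_image Ω

/-- Images of segments. [folklore] -/
theorem image_segment' (G : ℂ ≃ₗᵢ[ℝ] ℂ) (a b : ℂ) : G '' segment ℝ a b = segment ℝ (G a) (G b) := by
  have := image_segment ℝ G.toLinearEquiv.toLinearMap.toAffineMap a b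
  simpa using this

/-- Images of closures. [folklore] -/
theorem image_closure' (G : ℂ ≃ₗᵢ[ℝ] ℂ) (s : Set ℂ) : G '' closure s = closure (G '' s) :=
  G.toHomeomorph.image_closure s

/-- Images of frontiers. [folklore] -/
theorem image_frontier' (G : ℂ ≃ₗᵢ[ℝ] ℂ) (s : Set ℂ) : G '' frontier s = frontier (G '' s) :=
  G.toHomeomorph.image_frontier s

/-- **Distance to the frontier is invariant.** [folklore] -/
theorem infDist_frontier_image (G : ℂ ≃ₗᵢ[ℝ] ℂ) (Ω : Set ℂ) (z : ℂ) :
    infDist (G z) (frontier (G '' Ω)) = infDist z (frontier Ω) := by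
  rw [← image_frontier', Metric.infDist_image G.isometry]

/-! ### Lattice adjacency and mesh vertices -/

/-- **Lattice adjacency is preserved** (`δ > 0`): adjacency means mesh points at distance `δ`,
and `G` is an isometry. [folklore] -/
theorem zdAdj_map_of_adj (hδ : 0 < δ) (hG : ∀ x : Site 2, meshPoint δ (g x) = G (meshPoint δ x))
    {x y : Site 2} (h : (zdGraph 2).Adj x y) : (zdGraph 2).Adj (g x) (g y) := by
  have hd : dist (meshPoint δ (g x)) (meshPoint δ (g y)) ≤ δ := by
    rw [hG, hG, G.dist_map, dist_meshPoint_of_adj h, abs_of_pos hδ]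
  have hne : g y ≠ g x := fun heq => h.ne (g.injective heq).symm
  rw [dist_comm] at hd
  exact adj_of_dist_le hδ hne hd

/-- Lattice adjacency along a lattice isometry. [folklore] -/
theorem zdAdj_map_iff (hδ : 0 < δ) (hG : ∀ x : Site 2, meshPoint δ (g x) = G (meshPoint δ x))
    {x y : Site 2} : (zdGraph 2).Adj (g x) (g y) ↔ (zdGraph 2).Adj x y := by
  refine ⟨fun h => ?_, zdAdj_map_of_adj hδ hG⟩
  have := zdAdj_map_of_adj (g := g.symm) (G := G.symm) hδ (meshPoint_symm hG) h
  simpa using this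

/-- Mesh vertices along a lattice isometry. [folklore] -/
theorem mem_meshVertices_map_iff (hG : ∀ x : Site 2, meshPoint δ (g x) = G (meshPoint δ x))
    {x : Site 2} : g x ∈ meshVertices (G '' Ω) δ ↔ x ∈ meshVertices Ω δ := by
  rw [mem_meshVertices_iff, mem_meshVertices_iff, hG, G.injective.mem_set_image]

/-- The mesh graph along a lattice isometry. [folklore] -/
theorem meshGraph_adj_map_iff (hδ : 0 < δ) (hG : ∀ x : Site 2, meshPoint δ (g x) = G (meshPoint δ x))
    {x y : Site 2} : (meshGraph (G '' Ω) δ).Adj (g x) (g y) ↔ (meshGraph Ω δ).Adj x y := by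
  rw [meshGraph_adj_iff, meshGraph_adj_iff, zdAdj_map_iff hδ hG, hG, hG, ← image_segment',
    ← image_closure', image_subset_image_iff G.injective]

/-- `g` maps mesh vertices of `Ω` to mesh vertices of `G Ω`. [folklore] -/
theorem mapsTo_meshVertices (hG : ∀ x : Site 2, meshPoint δ (g x) = G (meshPoint δ x)) :
    MapsTo g (meshVertices Ω δ) (meshVertices (G '' Ω) δ) :=
  fun _ hx => (mem_meshVertices_map_iff hG).2 hx

/-- Reachability in the mesh vertex graph is pushed forward along a lattice isometry. [folklore] -/
theorem reachable_map_of_reachable (hδ : 0 < δ) (hG : ∀ x : Site 2, meshPoint δ (g x) = G (meshPoint δ x))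
    {x y : Site 2} (hx : x ∈ meshVertices Ω δ) (hy : y ∈ meshVertices Ω δ)
    (h : (meshVertexGraph Ω δ).Reachable ⟨x, hx⟩ ⟨y, hy⟩) :
    (meshVertexGraph (G '' Ω) δ).Reachable ⟨g x, mapsTo_meshVertices hG hx⟩ ⟨g y, mapsTo_meshVertices hG hy⟩ :=
  h.map (SimpleGraph.induceHom (G' := meshGraph (G '' Ω) δ)
    ⟨g, fun hxy => (meshGraph_adj_map_iff hδ hG).2 hxy⟩ (mapsTo_meshVertices hG))

/-- **Reachability in the mesh vertex graph along a lattice isometry.** [folklore] -/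
theorem reachable_map_iff (hδ : 0 < δ) (hG : ∀ x : Site 2, meshPoint δ (g x) = G (meshPoint δ x))
    {x y : Site 2} (hx : g x ∈ meshVertices (G '' Ω) δ) (hy : g y ∈ meshVertices (G '' Ω) δ) :
    (meshVertexGraph (G '' Ω) δ).Reachable ⟨g x, hx⟩ ⟨g y, hy⟩ ↔
      (meshVertexGraph Ω δ).Reachable ⟨x, (mem_meshVertices_map_iff hG).1 hx⟩
        ⟨y, (mem_meshVertices_map_iff hG).1 hy⟩ := by
  constructor
  · intro h
    have h' := reachable_map_of_reachable (g := g.symm) (G := G.symm) hδ (meshPoint_symm hG) hx hy h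
    rw [reachable_congr_set (symm_image_image G Ω)] at h'
    convert h' using 2 <;> simp
  · intro h
    exact reachable_map_of_reachable hδ hG _ _ h

/-! ### The discrete domain (largest component) -/

/-- The support of the component of `g x` in `G Ω` is the `g`-image of the support of the
component of `x` in `Ω`. [folklore] -/
theorem image_supp_map (hδ : 0 < δ) (hG : ∀ x : Site 2, meshPoint δ (g x) = G (meshPoint δ x))
    {x : Site 2} (hx : g x ∈ meshVertices (G '' Ω) δ) :
    Subtype.val '' ((meshVertexGraph (G '' Ω) δ).connectedComponentMk ⟨g x, hx⟩).supp =
      g '' (Subtype.val ''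
        ((meshVertexGraph Ω δ).connectedComponentMk ⟨x, (mem_meshVertices_map_iff hG).1 hx⟩).supp) := by
  ext z
  rw [mem_image_supp_iff, Set.mem_image]
  constructor
  · rintro ⟨hz, h⟩
    have hz' : g (g.symm z) ∈ meshVertices (G '' Ω) δ := by simpa using hz
    refine ⟨g.symm z, (mem_image_supp_iff _).2 ⟨(mem_meshVertices_map_iff hG).1 hz', ?_⟩, g.apply_symm_apply z⟩
    rw [← reachable_map_iff hδ hG hx hz']
    convert h using 2; simp
  · rintro ⟨w, hw, rfl⟩
    obtain ⟨hw, h⟩ := (mem_image_supp_iff _).1 hw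
    refine ⟨(mem_meshVertices_map_iff hG).2 hw, ?_⟩
    rw [reachable_map_iff hδ hG]
    exact h

/-- Component sizes are invariant along a lattice isometry. [folklore] -/
theorem ncard_supp_map (hδ : 0 < δ) (hG : ∀ x : Site 2, meshPoint δ (g x) = G (meshPoint δ x))
    {x : Site 2} (hx : g x ∈ meshVertices (G '' Ω) δ) :
    ((meshVertexGraph (G '' Ω) δ).connectedComponentMk ⟨g x, hx⟩).supp.ncard =
      ((meshVertexGraph Ω δ).connectedComponentMk
        ⟨x, (mem_meshVertices_map_iff hG).1 hx⟩).supp.ncard := by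
  rw [← Set.ncard_image_of_injective _ Subtype.val_injective, image_supp_map hδ hG hx,
    Set.ncard_image_of_injective _ g.injective,
    Set.ncard_image_of_injective _ Subtype.val_injective]

/-- **The discrete domain along a lattice isometry**: `g x ∈ (G Ω)_δ ↔ x ∈ Ω_δ`. [folklore] -/
theorem mem_meshDomain_map_iff (hδ : 0 < δ) (hG : ∀ x : Site 2, meshPoint δ (g x) = G (meshPoint δ x))
    {x : Site 2} : g x ∈ meshDomain (G '' Ω) δ ↔ x ∈ meshDomain Ω δ := by
  rw [mem_meshDomain_iff_ncard, mem_meshDomain_iff_ncard]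
  constructor
  · rintro ⟨hx, h⟩
    refine ⟨(mem_meshVertices_map_iff hG).1 hx, fun y hy => ?_⟩
    have hy' : g y ∈ meshVertices (G '' Ω) δ := (mem_meshVertices_map_iff hG).2 hy
    have := h (g y) hy'
    rwa [ncard_supp_map hδ hG hy', ncard_supp_map hδ hG hx] at this
  · rintro ⟨hx, h⟩
    have hx' : g x ∈ meshVertices (G '' Ω) δ := (mem_meshVertices_map_iff hG).2 hx
    refine ⟨hx', fun y hy => ?_⟩
    have hy' : g (g.symm y) ∈ meshVertices (G '' Ω) δ := by simpa using hy
    have := h (g.symm y) ((mem_meshVertices_map_iff hG).1 hy')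
    rw [← ncard_supp_map hδ hG hy', ← ncard_supp_map hδ hG hx'] at this
    convert this using 4; simp

/-- **The graph `Ω_δ` along a lattice isometry.** [folklore] -/
theorem ddg_adj_map_iff (hδ : 0 < δ) (hG : ∀ x : Site 2, meshPoint δ (g x) = G (meshPoint δ x))
    {x y : Site 2} :
    (discreteDomainGraph (G '' Ω) δ).Adj (g x) (g y) ↔ (discreteDomainGraph Ω δ).Adj x y := by
  rw [discreteDomainGraph_adj_iff, discreteDomainGraph_adj_iff, meshGraph_adj_map_iff hδ hG,
    mem_meshDomain_map_iff hδ hG, mem_meshDomain_map_iff hδ hG]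

/-- The vertex boundary `meshBoundary` along a lattice isometry. [folklore] -/
theorem mem_meshBoundary_map_iff (hδ : 0 < δ) (hG : ∀ x : Site 2, meshPoint δ (g x) = G (meshPoint δ x))
    {x : Site 2} : g x ∈ meshBoundary (G '' Ω) δ ↔ x ∈ meshBoundary Ω δ := by
  rw [mem_meshBoundary_iff, mem_meshBoundary_iff, mem_meshDomain_map_iff hδ hG]
  refine and_congr_right fun _ => ⟨?_, ?_⟩
  · rintro ⟨y, hy, hn⟩
    refine ⟨g.symm y, ?_, fun h => hn ?_⟩
    · rw [← zdAdj_map_iff hδ hG (g := g)]; simpa using hy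
    · have := (ddg_adj_map_iff hδ hG (g := g)).2 h; simpa using this
  · rintro ⟨y, hy, hn⟩
    exact ⟨g y, (zdAdj_map_iff hδ hG).2 hy, fun h => hn ((ddg_adj_map_iff hδ hG).1 h)⟩

end Transport

end Summit.CriticalPhenomena.CardyFormulaZ2.Theorems.DiscretisationFamilyExists

end
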